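import Summits.BirchSwinnertonDyer.BirchSwinnertonDyer.Theorems.ThetaPartnerAtTwoSignedControlAtTwoPlusKimOfPrint
import Summits.BirchSwinnertonDyer.BirchSwinnertonDyer.Theorems.ThetaPartnerAtTwoSignedControlAtTwoPlusKimKummerDescent
import Summits.BirchSwinnertonDyer.BirchSwinnertonDyer.Theorems.ByReductionTypeAtTwoSupersingularTowerTorsionTwo
import HarnessLib

/-!
# The door of part 4 with LOC^ε@2 in the LEVEL-`∞` Kummer form: COINV^ε@2, KIM^ε@2 and EC2 from the five PRINT facts,
# `Sel_{2^∞}(E/ℚ)` finite, INJ⁺@2 and «`H¹(ℚ₂, E)[2^∞] ↠ (H¹(ℚ_{2,∞}, E[2^∞]) / E^ε_∞ ⊗ ℚ₂/ℤ₂)^Γ`» phrased through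
# `localKummerOverOfEmb W 2 (ker κ) (closureEmb ℚ₂) (⨆ₙ E^ε(ℚ_{2,n}))` — KIM⁺ series part 6

Route `ThetaPartnerAtTwo` (TP2; crux shared with `ResidualThetaTransportAtTwo`), crux K4 `SignedControlAtTwo`
(stmt-BirchSwinnertonDyer-20309), line `eulerchar` v4, stub `stub_plusKimNoFiniteSubmoduleTwo` (KIM⁺@2). Seat
`prover-bsd-wall-tp2-p3-w2` (width seat 2/3). Part 5 (`…PlusKimKummerDescent`) proved that the level-`∞` signed
Kummer condition descends to a finite layer when `E(K_∞·K_v)` has no `p`-torsion; at a good supersingular `2` that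
torsion-freeness is the tree theorem `SSFlatEC.eq_zero_of_mem_localTowerPointsOfEmb_of_two_nsmul` (Sprung 2012
Lemma 2.3 at `2`). So the `±`-local residue LOC^ε@2 of part 4 may be DISPLAYED as «for every
`t ∈ H¹(ℚ_Σ/ℚ_∞, E[2^∞])` `Γ_ℚ`-invariant modulo `Sel^ε_∞`, at the place `w ∋ 2` a `2`-power-torsion
`x_w ∈ H¹(Γ_{ℚ₂}, E(ℚ̄₂))` with `loc_w y = x_w ⇒ t − res y ∈ localKummerOverOfEmb W 2 (ker κ) (closureEmb ℚ_w)
(⨆ₙ E^ε(ℚ_{2,n}·ℚ_w))`» — Greenberg's Lemma 4.7 surjectivity at the supersingular place for the signed quotient,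
i.e. `(E^ε(ℚ_{2,∞}) ⊗ ℚ₂/ℤ₂)_Γ = 0` given `cd₂ Γ = 1` (B. D. Kim 2013 Props. 2.2–2.3 / Kitajima–Otsuki 2018 Prop. 1.5 at
ODD `p`; not in print at `2`) — the SAME subgroup through which the sibling seat w3 phrases INJ⁺@2
(`…PlusLocalInjOfLift`: `signedSelmerInfty ≤ localKummerOverOfEmb … (⨆ₙ E^ε)`; INJ⁺@2 ⟸ «invariant classes of
`E⁺_∞ ⊗ ℚ₂/ℤ₂` come from `E(ℚ₂)`»). K4 on line `eulerchar` = PUB {Prop. 4.13, Prop. 4.12, pp. 119–120, p. 108,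
p. 140 / Kato 12.4} ∘ THEOREM ∘ {INJ⁺@2, LOC⁺@2}: invariants and coinvariants of ONE local object.
HONEST FRAMING: THEOREMS ONLY (no definition, no named fact, no `sorry`), route-independent; nothing about any curve
is asserted; closes no item; BSD is not proved by any of this.

References: [GreenbergLNM1716] §4 Lemma 4.7 (pp. 107–108), Prop. 4.12, Prop. 4.13 / p. 122, pp. 119–120, §5 p. 140;
[BDKim2013] Props. 2.2–2.3, Thm. 1.1, Thm. 3.14, Cor. 3.15; [KitajimaOtsuki2018] Prop. 1.5; [Kobayashi2003] Def. 1.1;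
[Sprung2012] Lemma 2.3; [Kato2004Asterisque] Thm. 12.4.
-/

set_option autoImplicit false
-- the Theorems namespace of this sub repeats the summit name by design (D-0017 nested layout)
set_option linter.dupNamespace false

noncomputable section

open scoped Classical NumberField

open NumberField IsDedekindDomain

namespace Summit.BirchSwinnertonDyer.BirchSwinnertonDyer.Theorems.SignedEC

open Literature.NumberTheory.EllipticCurves Literature.NumberTheory.GaloisRepresentations
  WeierstrassCurve ZpExtension Literature.NumberTheory.EllipticCurves.Kobayashi2003
  Literature.NumberTheory.EllipticCurves.Sprung2012 Literature.NumberTheory.EllipticCurves.IwasawaDual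
  Literature.NumberTheory.EllipticCurves.IwasawaAlgebra Literature.NumberTheory.EllipticCurves.GreenbergVatsal2000

section Two

open Literature.NumberTheory.EllipticCurves.Rank1Residual

variable (W : WeierstrassCurve ℚ) [W.IsElliptic] [W.IsGloballyMinimal] (κ : ZpExtension ℚ 2) (ε : ℤˣ)

/-- **LOC^ε@2 in the level-`∞` Kummer form implies the layer form of part 4** at a good supersingular `2`
(`E(ℚ_∞·ℚ₂)[2] = 0`: `SSFlatEC.eq_zero_of_mem_localTowerPointsOfEmb_of_two_nsmul`), place by place and class by
class; the classical clause is implied. [cite: Kobayashi2003, Def. 1.1] [cite: Sprung2012, Lemma 2.3 (p. 1487)] -/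
theorem plusLocLayer_of_plusLocKummer (hss : GoodSS W 2) {w : HeightOneSpectrum (𝓞 ℚ)}
    (hw : ((2 : ℕ) : 𝓞 ℚ) ∈ w.asIdeal) {s : W.subgroupH1 2 κ.kerSubgroup}
    (hs : s ∈ localKummerOverOfEmb W 2 κ.kerSubgroup (closureEmb (K := ℚ) (w.adicCompletion ℚ))
      (⨆ n, signedLocalPoints κ (w.adicCompletion ℚ) W ε n)) :
    s ∈ W.localKerOver 2 κ.kerSubgroup (w.adicCompletion ℚ) ∧
      ∃ (n : ℕ) (d : W.subgroupH1 2 (κ.layerSubgroup n)),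
        d ∈ localKummerOverOfEmb W 2 (κ.layerSubgroup n) (closureEmb (K := ℚ) (w.adicCompletion ℚ))
          (signedLocalPoints κ (w.adicCompletion ℚ) W ε n) ∧
        W.layerToInfty κ n d = s := by
  have hw' : (2 : 𝓞 ℚ) ∈ w.asIdeal := by exact_mod_cast hw
  have hnt : ∀ P ∈ localTowerPointsOfEmb κ (closureEmb (K := ℚ) (w.adicCompletion ℚ)) W, 2 • P = 0 → P = 0 :=
    fun P hP h2 ↦ SSFlatEC.eq_zero_of_mem_localTowerPointsOfEmb_of_two_nsmul W hss κ hw' _ hP h2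
  exact ⟨mem_localKerOver_of_mem_localKummerOverOfEmb_iSup W κ _ ε hs,
    exists_signedKummerLayer_of_mem_localKummerOverOfEmb_iSup W κ _ ε hnt hs⟩

/-- **THE DOOR with LOC^ε@2 in the level-`∞` Kummer form** (and no classical clause): `(Sel^ε(E/ℚ_∞))_γ = 0` from the
five PRINT facts by name, `Sel_{2^∞}(E/ℚ)` finite, and «for every `t ∈ H¹(ℚ_Σ/ℚ_∞, E[2^∞])` `Γ_ℚ`-invariant modulo
`Sel^ε_∞`, at the place(s) `w ∋ 2` a `2`-power-torsion `x_w ∈ H¹(Γ_{ℚ₂}, E(ℚ̄₂))` with `loc_w y = x_w ⇒ t − res y ∈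
localKummerOverOfEmb W 2 (ker κ) (closureEmb ℚ_w) (⨆ₙ E^ε(ℚ_{2,n}·ℚ_w))`» — the surjectivity
`H¹(ℚ₂, E)[2^∞] ↠ (H¹(ℚ_{2,∞}, E[2^∞]) / E^ε_∞ ⊗ ℚ₂/ℤ₂)^Γ` of Greenberg's Lemma 4.7 at the supersingular place,
i.e. `(E^ε(ℚ_{2,∞}) ⊗ ℚ₂/ℤ₂)_Γ = 0` given `cd₂ Γ = 1`. [cite: GreenbergLNM1716, §4 Lemma 4.7 (pp. 107–108), Prop. 4.12,
Prop. 4.13, pp. 119–120, §5 p. 140] [cite: BDKim2013, Props. 2.2–2.3 and proof of Cor. 3.15] -/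
theorem signedEndCoinvariants_subsingleton_two_of_print_of_kummerLoc (hss : GoodSS W 2) (hκ : κ.IsCyclotomic)
    {γ : Field.absoluteGaloisGroup ℚ} (hγ : κ.IsTopGenerator γ)
    (S₀ : Finset (HeightOneSpectrum (𝓞 ℚ)))
    (hgood : ∀ w : HeightOneSpectrum (𝓞 ℚ), w ∉ S₀ → ((2 : ℕ) : 𝓞 ℚ) ∉ w.asIdeal → W.HasGoodReductionAt w)
    (hC : Greenberg1999.casselsSurjectivity_H1Sigma ℚ)
    (h412 : Greenberg1999.prop412_noFiniteSubmodule_H1Sigma_of_rank_one)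
    (hcork : Greenberg1999.h1Sigma_zpCorank_le_degree ℚ)
    (hP108 : Greenberg1999.localQuotient_restriction_surjective ℚ)
    (hWL : Greenberg1999.h1SigmaInfty_rank_eq_one)
    (hlocK : ∀ t ∈ unramifiedOutside κ.kerSubgroup (W.geomPrimaryTorsion 2) 2
        (↑S₀ : Set (HeightOneSpectrum (𝓞 ℚ))),
      (∀ σ : Field.absoluteGaloisGroup ℚ, W.conjH1 2 κ.kerSubgroup σ t - t ∈ signedSelmerInfty W κ ε) →
      ∀ w : HeightOneSpectrum (𝓞 ℚ), ((2 : ℕ) : 𝓞 ℚ) ∈ w.asIdeal →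
      ∃ xw : discreteH1 (localSubgroup (⊤ : Subgroup (Field.absoluteGaloisGroup ℚ)) (w.adicCompletion ℚ))
          (localPoints W (w.adicCompletion ℚ)),
        (∃ k : ℕ, 2 ^ k • xw = 0) ∧
        ∀ y : W.subgroupH1 2 (⊤ : Subgroup (Field.absoluteGaloisGroup ℚ)),
          W.localResOver 2 ⊤ (w.adicCompletion ℚ) y = xw →
          t - W.resOfLe 2 (le_top : κ.kerSubgroup ≤ ⊤) y ∈
            localKummerOverOfEmb W 2 κ.kerSubgroup (closureEmb (K := ℚ) (w.adicCompletion ℚ))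
              (⨆ n, signedLocalPoints κ (w.adicCompletion ℚ) W ε n))
    (hSel : Finite (W.selmerGroupPInfty 2)) :
    Subsingleton (EndCoinvariants (conjSignedSelmerInfty W κ ε γ - 1)) := by
  refine signedEndCoinvariants_subsingleton_two_of_print W κ ε hss hκ hγ S₀ hgood hC h412 hcork hP108 hWL
    (fun t ht hconj w hw ↦ ?_) hSel
  obtain ⟨xw, hx, hmain⟩ := hlocK t ht hconj w hw
  exact ⟨xw, hx, fun y hy ↦ plusLocLayer_of_plusLocKummer W κ ε hss hw (hmain y hy)⟩

/-- **KIM^ε@2 with LOC^ε@2 in the level-`∞` Kummer form**: under the same hypotheses every Pontryagin-dual datum of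
`Sel^ε(E/ℚ_∞)` has no nonzero finite `Λ`-submodule (the conclusion of the registered stub for the curve and datum at
hand). [cite: BDKim2013, Thm. 1.1 and Thm. 3.14] [cite: GreenbergLNM1716, §4 Prop. 4.12, Prop. 4.13, Lemma 4.7] -/
theorem signed_forall_noFiniteSubmodule_two_of_print_of_kummerLoc (hss : GoodSS W 2) (hκ : κ.IsCyclotomic)
    {γ : Field.absoluteGaloisGroup ℚ} (hγ : κ.IsTopGenerator γ)
    (S₀ : Finset (HeightOneSpectrum (𝓞 ℚ)))
    (hgood : ∀ w : HeightOneSpectrum (𝓞 ℚ), w ∉ S₀ → ((2 : ℕ) : 𝓞 ℚ) ∉ w.asIdeal → W.HasGoodReductionAt w)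
    (hC : Greenberg1999.casselsSurjectivity_H1Sigma ℚ)
    (h412 : Greenberg1999.prop412_noFiniteSubmodule_H1Sigma_of_rank_one)
    (hcork : Greenberg1999.h1Sigma_zpCorank_le_degree ℚ)
    (hP108 : Greenberg1999.localQuotient_restriction_surjective ℚ)
    (hWL : Greenberg1999.h1SigmaInfty_rank_eq_one)
    (hlocK : ∀ t ∈ unramifiedOutside κ.kerSubgroup (W.geomPrimaryTorsion 2) 2
        (↑S₀ : Set (HeightOneSpectrum (𝓞 ℚ))),
      (∀ σ : Field.absoluteGaloisGroup ℚ, W.conjH1 2 κ.kerSubgroup σ t - t ∈ signedSelmerInfty W κ ε) →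
      ∀ w : HeightOneSpectrum (𝓞 ℚ), ((2 : ℕ) : 𝓞 ℚ) ∈ w.asIdeal →
      ∃ xw : discreteH1 (localSubgroup (⊤ : Subgroup (Field.absoluteGaloisGroup ℚ)) (w.adicCompletion ℚ))
          (localPoints W (w.adicCompletion ℚ)),
        (∃ k : ℕ, 2 ^ k • xw = 0) ∧
        ∀ y : W.subgroupH1 2 (⊤ : Subgroup (Field.absoluteGaloisGroup ℚ)),
          W.localResOver 2 ⊤ (w.adicCompletion ℚ) y = xw →
          t - W.resOfLe 2 (le_top : κ.kerSubgroup ≤ ⊤) y ∈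
            localKummerOverOfEmb W 2 κ.kerSubgroup (closureEmb (K := ℚ) (w.adicCompletion ℚ))
              (⨆ n, signedLocalPoints κ (w.adicCompletion ℚ) W ε n))
    (hSel : Finite (W.selmerGroupPInfty 2)) :
    ∀ (D : SignedSelmerDualData W κ γ ε) [Module.Finite (IwasawaAlgebra 2) D.X],
      Module.IsTorsion (IwasawaAlgebra 2) D.X →
      ∀ N : Submodule (IwasawaAlgebra 2) D.X, Finite N → N = ⊥ := by
  intro D _ _
  haveI := signedEndCoinvariants_subsingleton_two_of_print_of_kummerLoc W κ ε hss hκ hγ S₀ hgood hC h412 hcork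
    hP108 hWL hlocK hSel
  exact signed_forall_finite_eq_bot_of_endCoinvariants_subsingleton D hγ

/-- **EC2 (the skeleton's `signedEulerCharTwo` body for `W`, `κ`, `γ`) from INJ⁺@2 + the five PRINT facts + LOC⁺@2 in
the level-`∞` Kummer form** — so on line `eulerchar` the crux K4 reads: PUB {Prop. 4.13, Prop. 4.12, pp. 119–120,
p. 108, p. 140 / Kato 12.4} ∘ THEOREM ∘ {INJ⁺@2, LOC⁺@2}, the two `±`-local statements both phrased through the ONE
subgroup `localKummerOverOfEmb W 2 (ker κ) (closureEmb ℚ₂) (⨆ₙ E⁺(ℚ_{2,n}·ℚ₂))` of `H¹(ℚ_∞, E[2^∞])`.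
[cite: BDKim2013, Cor. 3.15] [cite: GreenbergLNM1716, §4 pp. 102–109, Prop. 4.12, Prop. 4.13, pp. 119–122, §5 p. 140] -/
theorem signedEulerChar_two_of_localInj_of_print_of_kummerLoc (hss : GoodSS W 2) (hκ : κ.IsCyclotomic)
    {γ : Field.absoluteGaloisGroup ℚ} (hγ : κ.IsTopGenerator γ)
    (S₀ : Finset (HeightOneSpectrum (𝓞 ℚ)))
    (hgood : ∀ w : HeightOneSpectrum (𝓞 ℚ), w ∉ S₀ → ((2 : ℕ) : 𝓞 ℚ) ∉ w.asIdeal → W.HasGoodReductionAt w)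
    (hinj : ∀ v : HeightOneSpectrum (𝓞 ℚ), (2 : 𝓞 ℚ) ∈ v.asIdeal →
      ∀ y ∈ (signedSelmerInfty W κ 1).comap (W.layerToInfty κ 0),
        W.localResOver 2 (κ.layerSubgroup 0) (v.adicCompletion ℚ) y = 0)
    (hC : Greenberg1999.casselsSurjectivity_H1Sigma ℚ)
    (h412 : Greenberg1999.prop412_noFiniteSubmodule_H1Sigma_of_rank_one)
    (hcork : Greenberg1999.h1Sigma_zpCorank_le_degree ℚ)
    (hP108 : Greenberg1999.localQuotient_restriction_surjective ℚ)
    (hWL : Greenberg1999.h1SigmaInfty_rank_eq_one)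
    (hlocK : ∀ t ∈ unramifiedOutside κ.kerSubgroup (W.geomPrimaryTorsion 2) 2
        (↑S₀ : Set (HeightOneSpectrum (𝓞 ℚ))),
      (∀ σ : Field.absoluteGaloisGroup ℚ, W.conjH1 2 κ.kerSubgroup σ t - t ∈ signedSelmerInfty W κ 1) →
      ∀ w : HeightOneSpectrum (𝓞 ℚ), ((2 : ℕ) : 𝓞 ℚ) ∈ w.asIdeal →
      ∃ xw : discreteH1 (localSubgroup (⊤ : Subgroup (Field.absoluteGaloisGroup ℚ)) (w.adicCompletion ℚ))
          (localPoints W (w.adicCompletion ℚ)),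
        (∃ k : ℕ, 2 ^ k • xw = 0) ∧
        ∀ y : W.subgroupH1 2 (⊤ : Subgroup (Field.absoluteGaloisGroup ℚ)),
          W.localResOver 2 ⊤ (w.adicCompletion ℚ) y = xw →
          t - W.resOfLe 2 (le_top : κ.kerSubgroup ≤ ⊤) y ∈
            localKummerOverOfEmb W 2 κ.kerSubgroup (closureEmb (K := ℚ) (w.adicCompletion ℚ))
              (⨆ n, signedLocalPoints κ (w.adicCompletion ℚ) W 1 n))
    (hSel : Finite (W.selmerGroupPInfty 2)) :
    Finite (endInvariants (conjSignedSelmerInfty W κ 1 γ - 1)) ∧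
      ∃ u : ℤ_[2]ˣ, (Nat.card (endInvariants (conjSignedSelmerInfty W κ 1 γ - 1)) : ℚ_[2]) =
        ((u : ℤ_[2]) : ℚ_[2]) * ((2 : ℕ) : ℚ_[2]) ^ (padicValNat 2 W.tamagawaProduct) *
          (Nat.card (W.selmerGroupPInfty 2) : ℚ_[2]) *
            (Nat.card (EndCoinvariants (conjSignedSelmerInfty W κ 1 γ - 1)) : ℚ_[2]) :=
  signedEulerChar_two_of_localInj_of_cassels_of_coinv W hss κ hγ hinj
    (signedCasselsCountTwo_of_localInj_of_casselsSurjectivity W hC hss hκ hinj)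
    (fun hSel' _ ↦ by
      haveI := signedEndCoinvariants_subsingleton_two_of_print_of_kummerLoc W κ 1 hss hκ hγ S₀ hgood hC h412
        hcork hP108 hWL hlocK hSel'
      exact Nat.card_unique) hSel

end Two

end Summit.BirchSwinnertonDyer.BirchSwinnertonDyer.Theorems.SignedEC

end
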